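import Summits.KontsevichZagierPeriods.KontsevichZagierPeriods.Theses.AbelContraction
import Summits.KontsevichZagierPeriods.KontsevichZagierPeriods.Theorems.InverseLandauTateLiftingAffineChart
import Summits.KontsevichZagierPeriods.KontsevichZagierPeriods.Theorems.InverseLandauTateLiftingSimplexValue

/-!
# KontsevichZagierPeriods / AbelContraction — crux `RealArcKernel` (stmt-KontsevichZagierPeriods-12472),
# line `dimtwo_redirect`: equal-volume simplices are ONE change of variables apart

Answer to lead c3's `disprover-wanted` ("a tightness lemma showing rule (3) is load-bearing for
`stub_solidVolumes` already on rational polytopes (Dehn invariant)"): NO such lemma exists on simplices. Two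
simplex representations of the same dimension `n` — integrand `1` on affine images `A(Δ_n) + b`,
`A'(Δ_n) + b'` of the open ordered simplex `Δ_n = KZ.openOrderedSimplex n` with real-algebraic data and
`det A, det A' ≠ 0` — which have the SAME VALUE differ by a SINGLE generator of `KZ.changeOfVariablesRel`
(Kontsevich–Zagier's rule (2)): the affine map `Φ = (A' A⁻¹) x + (b' − A' A⁻¹ b)` carries the first
simplex onto the second, is `ℚ`-semialgebraic and injective, and has constant Jacobian
`|det A'| / |det A| = 1` because the values are `|det A| / n!` and `|det A'| / n!`
(`InverseLandau.tateLifting_simplexValue`). So the Dehn invariant of Hilbert's third problem (Dehn 1901,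
Sydler 1965), an obstruction to scissors congruence by ISOMETRIES, obstructs nothing in any sub-calculus
containing rule (2) with affine maps: a regular tetrahedron and a right-corner tetrahedron of equal volume
are one move apart; with dissections (rule (1a)) added, equal-volume rational polytopes are related without
rule (3) at all [cite: CressonViusos2022, Thm. 4.1] (Pak, *Lectures on Discrete and Polyhedral Geometry*,
Ex. 18.3). Rule (3) enters the polytope sector of the calculus only to compare DIFFERENT dimensions
(`InverseLandau.Polytope.simplex_toPoint`).

* `simplex_sub_simplex_mem_changeOfVariablesRel` — the registered special-case stub (one rule-(2) move).
* `simplex_equivalent_of_value_eq` — hence KZ-equivalent.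

References: M. Kontsevich, D. Zagier, *Periods* (2001), §1.2 rule (2); J. Cresson, J. Viu-Sos, JTNB 34
(2022), §4.1, Thm. 4.1–4.2; M. Dehn, Math. Ann. 55 (1901); J.-P. Sydler, Comment. Math. Helv. 40 (1965).
-/

noncomputable section

open MeasureTheory Set
open Literature.NumberTheory.Transcendental
open Summit.KontsevichZagierPeriods.InverseLandau

namespace Summit.KontsevichZagierPeriods.AbelContraction.RealArcKernelSimplexRuleTwo

/-- Entries of the inverse of a matrix with real-algebraic entries are real-algebraic
(`A⁻¹ = (det A)⁻¹ • adj A`, the adjugate entries being determinants of matrices with entries among those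
of `A` and `0`, `1`). [folklore] -/
theorem isAlgebraic_inv_apply {n : ℕ} {A : Matrix (Fin n) (Fin n) ℝ} (hA : ∀ i j, IsAlgebraic ℚ (A i j))
    (i j : Fin n) : IsAlgebraic ℚ (A⁻¹ i j) := by
  have hadj : IsAlgebraic ℚ (A.adjugate i j) := by
    rw [Matrix.adjugate_apply]
    refine AffineEngine.isAlgebraic_det fun k l => ?_
    rw [Matrix.updateRow_apply]
    split_ifs
    · rcases eq_or_ne l i with rfl | hne
      · rw [Pi.single_eq_same]; exact isAlgebraic_one
      · rw [Pi.single_eq_of_ne hne]; exact isAlgebraic_zero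
    · exact hA k l
  rw [Matrix.inv_def, Matrix.smul_apply, Ring.inverse_eq_inv', smul_eq_mul]
  have h1 : (A.det)⁻¹ ∈ algebraicClosure ℚ ℝ :=
    inv_mem (mem_algebraicClosure_iff.2 (AffineEngine.isAlgebraic_det hA))
  exact mem_algebraicClosure_iff.1 (mul_mem h1 (mem_algebraicClosure_iff.2 hadj))

/-- Entries of a product of matrices with real-algebraic entries are real-algebraic. [folklore] -/
theorem isAlgebraic_mul_apply {n : ℕ} {A B : Matrix (Fin n) (Fin n) ℝ} (hA : ∀ i j, IsAlgebraic ℚ (A i j))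
    (hB : ∀ i j, IsAlgebraic ℚ (B i j)) (i j : Fin n) : IsAlgebraic ℚ ((A * B) i j) := by
  rw [Matrix.mul_apply]
  exact mem_algebraicClosure_iff.1 (sum_mem fun k _ =>
    mul_mem (mem_algebraicClosure_iff.2 (hA i k)) (mem_algebraicClosure_iff.2 (hB k j)))

/-- Entries of `b' − M b` are real-algebraic when those of `M`, `b`, `b'` are. [folklore] -/
theorem isAlgebraic_sub_mulVec {n : ℕ} {M : Matrix (Fin n) (Fin n) ℝ} {b b' : Fin n → ℝ}
    (hM : ∀ i j, IsAlgebraic ℚ (M i j)) (hb : ∀ i, IsAlgebraic ℚ (b i)) (hb' : ∀ i, IsAlgebraic ℚ (b' i))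
    (i : Fin n) : IsAlgebraic ℚ ((b' - M.mulVec b) i) := by
  rw [Pi.sub_apply, Matrix.mulVec, dotProduct]
  exact mem_algebraicClosure_iff.1 (sub_mem (mem_algebraicClosure_iff.2 (hb' i))
    (sum_mem fun k _ => mul_mem (mem_algebraicClosure_iff.2 (hM i k)) (mem_algebraicClosure_iff.2 (hb k))))

/-- **Equal-volume simplices are ONE change of variables apart** (registered special-case stub of line
`dimtwo_redirect`; rule (2) alone, no dissection, no Newton–Leibniz): for integrand-`1` representations `r`,
`r'` over `A(Δ_n) + b`, `A'(Δ_n) + b'` (real-algebraic data, `det ≠ 0`) with `r.value = r'.value`, the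
difference `[r] − [r']` is a generator of `KZ.changeOfVariablesRel`, the move being the affine map
`x ↦ A' A⁻¹ x + (b' − A' A⁻¹ b)` of Jacobian `|det A'| / |det A| = 1`.
[cite: KontsevichZagier2001, §1.2 rule (2)] -/
theorem simplex_sub_simplex_mem_changeOfVariablesRel : ∀ {n : ℕ} (A : Matrix (Fin n) (Fin n) ℝ) (b : Fin n → ℝ) (A' : Matrix (Fin n) (Fin n) ℝ) (b' : Fin n → ℝ) (r r' : KZ.IntegralRep n), (∀ i j, IsAlgebraic ℚ (A i j)) → (∀ i, IsAlgebraic ℚ (b i)) → A.det ≠ 0 → r.domain = (fun x => A.mulVec x + b) '' KZ.openOrderedSimplex n → (∀ y ∈ r.domain, r.integrand y = 1) → (∀ i j, IsAlgebraic ℚ (A' i j)) → (∀ i, IsAlgebraic ℚ (b' i)) → A'.det ≠ 0 → r'.domain = (fun x => A'.mulVec x + b') '' KZ.openOrderedSimplex n → (∀ y ∈ r'.domain, r'.integrand y = 1) → r.value = r'.value → KZ.of r - KZ.of r' ∈ KZ.changeOfVariablesRel := by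
  intro n A b A' b' r r' hA hb hdet hdom hr1 hA' hb' hdet' hdom' hr1' hv
  -- equal values: `|det A| / n! = |det A'| / n!`
  have habs : |A.det| = |A'.det| := by
    have h1 := tateLifting_simplexValue n A b r hdom hr1
    have h2 := tateLifting_simplexValue n A' b' r' hdom' hr1'
    have hfac : (n.factorial : ℝ) ≠ 0 := by exact_mod_cast (Nat.factorial_pos n).ne'
    rw [hv, h2] at h1
    exact (div_left_inj' hfac).mp h1.symm
  -- the move `Φ x = M x + c`, `M = A' A⁻¹`, `c = b' − M b`
  have hU : IsUnit A.det := isUnit_iff_ne_zero.mpr hdet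
  set M : Matrix (Fin n) (Fin n) ℝ := A' * A⁻¹ with hM_def
  set c : Fin n → ℝ := b' - M.mulVec b with hc_def
  have hM : ∀ i j, IsAlgebraic ℚ (M i j) := isAlgebraic_mul_apply hA' (isAlgebraic_inv_apply hA)
  have hc : ∀ i, IsAlgebraic ℚ (c i) := isAlgebraic_sub_mulVec hM hb hb'
  have hMA : M * A = A' := by
    rw [hM_def, Matrix.mul_assoc, Matrix.nonsing_inv_mul A hU, Matrix.mul_one]
  have hMdet : M.det = A'.det * (A.det)⁻¹ := by
    rw [hM_def, Matrix.det_mul, Matrix.det_nonsing_inv, Ring.inverse_eq_inv']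
  have hMdet_ne : M.det ≠ 0 := by
    rw [hMdet]; exact mul_ne_zero hdet' (inv_ne_zero hdet)
  have hMabs : |M.det| = 1 := by
    rw [hMdet, abs_mul, abs_inv, ← habs, mul_inv_cancel₀ (abs_ne_zero.mpr hdet)]
  -- `Φ` carries the first simplex onto the second
  have hΦ : ∀ y, M.mulVec (A.mulVec y + b) + c = A'.mulVec y + b' := fun y => by
    rw [hc_def, Matrix.mulVec_add, Matrix.mulVec_mulVec, hMA]
    abel
  have hdom_eq : r'.domain = (fun x => M.mulVec x + c) '' r.domain := by
    rw [hdom', hdom, Set.image_image]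
    exact Set.image_congr fun y _ => (hΦ y).symm
  -- derivative and determinant of the affine move
  set L : (Fin n → ℝ) →L[ℝ] (Fin n → ℝ) := LinearMap.toContinuousLinearMap (Matrix.toLin' M) with hL
  have hLapply : ∀ x, L x = M.mulVec x := fun x => by
    rw [hL, LinearMap.coe_toContinuousLinearMap', Matrix.toLin'_apply]
  have hLdet : L.det = M.det := by
    rw [hL, LinearMap.det_toContinuousLinearMap, LinearMap.det_toLin']
  have hderiv : ∀ x, HasFDerivAt (fun x => M.mulVec x + c) L x := fun x => by
    have heq : (fun x => M.mulVec x + c) = fun x => L x + c := funext fun x => by rw [hLapply]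
    rw [heq]
    exact L.hasFDerivAt.add_const c
  refine ⟨n, r, r', fun x => M.mulVec x + c, fun _ => L,
    AffineEngine.isSemialgebraicMapOn_affine hM hc r.isSemialgebraic_domain,
    fun x _ => (hderiv x).hasFDerivWithinAt, (AffineEngine.affine_injective c hMdet_ne).injOn, hdom_eq,
    fun x hx => ?_, rfl⟩
  have hΦx : M.mulVec x + c ∈ r'.domain := by
    rw [hdom_eq]; exact Set.mem_image_of_mem _ hx
  rw [hr1 x hx, hr1' _ hΦx, hLdet, hMabs, mul_one]

/-- **Hence equal-volume simplices are KZ-equivalent by rule (2) alone.** [cite: KontsevichZagier2001, §1.2 rule (2)] -/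
theorem simplex_equivalent_of_value_eq {n : ℕ} (A : Matrix (Fin n) (Fin n) ℝ) (b : Fin n → ℝ)
    (A' : Matrix (Fin n) (Fin n) ℝ) (b' : Fin n → ℝ) (r r' : KZ.IntegralRep n)
    (hA : ∀ i j, IsAlgebraic ℚ (A i j)) (hb : ∀ i, IsAlgebraic ℚ (b i)) (hdet : A.det ≠ 0)
    (hdom : r.domain = (fun x => A.mulVec x + b) '' KZ.openOrderedSimplex n)
    (hr1 : ∀ y ∈ r.domain, r.integrand y = 1)
    (hA' : ∀ i j, IsAlgebraic ℚ (A' i j)) (hb' : ∀ i, IsAlgebraic ℚ (b' i)) (hdet' : A'.det ≠ 0)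
    (hdom' : r'.domain = (fun x => A'.mulVec x + b') '' KZ.openOrderedSimplex n)
    (hr1' : ∀ y ∈ r'.domain, r'.integrand y = 1) (hv : r.value = r'.value) :
    KZ.of r - KZ.of r' ∈ AddSubgroup.closure KZ.changeOfVariablesRel ∧ KZ.Equivalent r r' := by
  have h := simplex_sub_simplex_mem_changeOfVariablesRel A b A' b' r r' hA hb hdet hdom hr1 hA' hb' hdet'
    hdom' hr1' hv
  exact ⟨AddSubgroup.subset_closure h, KZ.changeOfVariablesRel_subset_relations h⟩

end Summit.KontsevichZagierPeriods.AbelContraction.RealArcKernelSimplexRuleTwo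

end
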